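import Literature.Analysis.FluidPDE.ElgindiSinRpowIntegral
import Literature.Analysis.FluidPDE.ElgindiTransportL2Coercivity
import HarnessLib

/-!
# The angular `L^∞` embedding of the weighted space ([ElgindiGhoulMasmoudi2021] Lemma 9.1)

Topic `Literature/Analysis/FluidPDE`. Proof file (everything proved, no definitions, no named
facts) on the proof path of the named fact
`Literature.Analysis.FluidPDE.Elgindi.ElgindiGhoulMasmoudi2021_stabilityCore`
(`ElgindiStabilityDecomposition.lean`). Elgindi–Ghoul–Masmoudi 2021 = arXiv:1910.14071, §9
Lemma 9.1 (p. 20 of the held text), first display: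

> "For all `z`, we have `sup_θ|g(z,θ)|² ≤ (C/√(γ−1))∫₀^{π/2}|∂_θg(z,θ)|² sin(2θ)^{2−γ}dθ`."

The one-dimensional inequality, for `C¹` functions compactly supported inside `(0, π/2)` (the
test-function class of the coercivity files) and `1 < γ ≤ 2`, by `g(θ) = ∫₀^θ g'`, Cauchy–Schwarz
with the weight `sin(2t)^{2−γ}` and `∫₀^{π/2}sin(2t)^{γ−2}dt ≤ π/(γ−1)`
(`integral_sin_two_mul_rpow_le`): `g(θ)² ≤ (π/(γ−1))∫₀^{π/2}g'²sin(2t)^{2−γ}dt`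
(`sq_le_integral_sq_deriv_angular`). The printed dependence `C/√(γ−1)` is not reproduced by this
argument; we prove and state the constant `π/(γ−1)` that it yields (the printed proofs of
[EGM] §9 only use "a constant depending on `γ`" at this point).
-/

noncomputable section

open MeasureTheory Set Real Filter intervalIntegral
open _root_.Topology

namespace Literature.Analysis.FluidPDE

namespace Elgindi

/-- A compactly supported function with support inside `(0, π/2)` vanishes below some `a > 0`. [folklore] -/
theorem exists_pos_forall_lt_eq_zero_Ioo {g : ℝ → ℝ} (hs : HasCompactSupport g) (hsub : tsupport g ⊆ Ioo 0 (π / 2)) :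
    ∃ a : ℝ, 0 < a ∧ ∀ s, s < a → g s = 0 := by
  rcases (tsupport g).eq_empty_or_nonempty with he | hne
  · exact ⟨1, one_pos, fun s _ => image_eq_zero_of_notMem_tsupport (by rw [he]; simp)⟩
  · obtain ⟨m, hm, hmin⟩ := hs.isCompact.exists_isMinOn hne continuous_id.continuousOn
    exact ⟨m, (hsub hm).1, fun s hs' => image_eq_zero_of_notMem_tsupport fun h => absurd (hmin h) (by simpa using hs')⟩

/-- **The angular `L^∞` embedding** (EGM Lemma 9.1, first inequality, with the constant
`π/(γ−1)`): for `1 < γ ≤ 2`, `g ∈ C¹(ℝ)` compactly supported inside `(0, π/2)` and every `θ`,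
`g(θ)² ≤ (π/(γ−1))·∫_{(0,π/2)} g'(t)²sin(2t)^{2−γ}dt`. [cite: ElgindiGhoulMasmoudi2021, §9 Lemma 9.1 (p. 20 of arXiv:1910.14071)] -/
theorem sq_le_integral_sq_deriv_angular {γ : ℝ} (hγ1 : 1 < γ) (hγ2 : γ ≤ 2) {g : ℝ → ℝ} (hg : ContDiff ℝ 1 g)
    (hs : HasCompactSupport g) (hsub : tsupport g ⊆ Ioo 0 (π / 2)) (θ : ℝ) :
    g θ ^ 2 ≤ π / (γ - 1) * ∫ t in Ioo 0 (π / 2), deriv g t ^ 2 * Real.sin (2 * t) ^ (2 - γ) := by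
  have hgc : Continuous g := hg.continuous
  have hdc : Continuous (deriv g) := hg.continuous_deriv le_rfl
  have hd : Differentiable ℝ g := hg.differentiable (by simp)
  obtain ⟨a, ha, hga⟩ := exists_pos_forall_lt_eq_zero_Ioo hs hsub
  have hg0 : g 0 = 0 := hga 0 ha
  -- the weighted integrand `Φ = g'·sin^{(2−γ)/2}` and the weight `ψ = sin^{(γ−2)/2}` on `(0, π/2)`
  set r : ℝ := γ - 2 with hr
  have hr1 : -1 < r := by rw [hr]; linarith
  have hr0 : r ≤ 0 := by rw [hr]; linarith
  have hW : IntegrableOn (fun t : ℝ => Real.sin (2 * t) ^ r) (Ioo 0 (π / 2)) := integrableOn_sin_two_mul_rpow hr1 hr0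
  have hWle : ∫ t in Ioo 0 (π / 2), Real.sin (2 * t) ^ r ≤ π / (γ - 1) := by
    have := integral_sin_two_mul_rpow_le hr1 hr0
    rw [show r + 1 = γ - 1 by rw [hr]; ring] at this
    exact this
  -- the global weighted integral of `g'²`
  have hB : IntegrableOn (fun t => deriv g t ^ 2 * Real.sin (2 * t) ^ (2 - γ)) (Ioo 0 (π / 2)) := by
    have hc : ContinuousOn (fun t => deriv g t ^ 2 * Real.sin (2 * t) ^ (2 - γ)) (Icc 0 (π / 2)) :=
      ((hdc.pow 2).continuousOn).mul (ContinuousOn.rpow_const (by fun_prop) fun t _ => Or.inr (by linarith))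
    exact (hc.integrableOn_compact isCompact_Icc).mono_set Ioo_subset_Icc_self
  have hBnn : 0 ≤ ∫ t in Ioo 0 (π / 2), deriv g t ^ 2 * Real.sin (2 * t) ^ (2 - γ) :=
    setIntegral_nonneg measurableSet_Ioo fun t ht => mul_nonneg (sq_nonneg _)
      (Real.rpow_nonneg (Real.sin_pos_of_pos_of_lt_pi (by linarith [ht.1]) (by linarith [ht.2])).le _)
  -- outside `(0, π/2)` the function vanishes
  by_cases hθ : θ ∈ Ioo 0 (π / 2)
  swap
  · have : g θ = 0 := image_eq_zero_of_notMem_tsupport fun h => hθ (hsub h)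
    rw [this]
    have : 0 ≤ π / (γ - 1) := div_nonneg Real.pi_pos.le (by linarith)
    simpa using mul_nonneg this hBnn
  -- `g θ = ∫_{(0,θ]} g' = ∫_{(0,θ)} Φ ψ`
  have hFTC : g θ = ∫ t in Ioo 0 θ, deriv g t := by
    rw [← integral_Ioc_eq_integral_Ioo, ← intervalIntegral.integral_of_le hθ.1.le,
      intervalIntegral.integral_deriv_eq_sub (fun s _ => hd s) (hdc.intervalIntegrable _ _), hg0, sub_zero]
  set Φ : ℝ → ℝ := fun t => deriv g t * Real.sin (2 * t) ^ ((2 - γ) / 2) with hΦ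
  set ψ : ℝ → ℝ := fun t => Real.sin (2 * t) ^ (r / 2) with hψ
  have hsin : ∀ t ∈ Ioo 0 (π / 2), 0 < Real.sin (2 * t) := fun t ht =>
    Real.sin_pos_of_pos_of_lt_pi (by linarith [ht.1]) (by linarith [ht.2])
  have hsub' : Ioo 0 θ ⊆ Ioo 0 (π / 2) := fun t ht => ⟨ht.1, ht.2.trans hθ.2⟩
  have hrepr : ∫ t in Ioo 0 θ, deriv g t = ∫ t in Ioo 0 θ, Φ t * ψ t := by
    refine setIntegral_congr_fun measurableSet_Ioo fun t ht => ?_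
    have hs' := hsin t (hsub' ht)
    simp only [hΦ, hψ]
    rw [mul_assoc, ← Real.rpow_add hs', show (2 - γ) / 2 + r / 2 = 0 by rw [hr]; ring, Real.rpow_zero, mul_one]
  -- the squares
  have hΦ2 : ∀ t ∈ Ioo 0 (π / 2), Φ t ^ 2 = deriv g t ^ 2 * Real.sin (2 * t) ^ (2 - γ) := by
    intro t ht
    simp only [hΦ]
    rw [mul_pow, ← Real.rpow_natCast (Real.sin (2 * t) ^ ((2 - γ) / 2)) 2, ← Real.rpow_mul (hsin t ht).le]
    norm_num
  have hψ2 : ∀ t ∈ Ioo 0 (π / 2), ψ t ^ 2 = Real.sin (2 * t) ^ r := by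
    intro t ht
    simp only [hψ]
    rw [← Real.rpow_natCast (Real.sin (2 * t) ^ (r / 2)) 2, ← Real.rpow_mul (hsin t ht).le]
    norm_num
  -- integrability on `(0, θ)`
  have hmΦ : AEStronglyMeasurable Φ (volume.restrict (Ioo 0 θ)) := by
    refine (ContinuousOn.mono ?_ hsub').aestronglyMeasurable measurableSet_Ioo
    exact hdc.continuousOn.mul (ContinuousOn.rpow_const (by fun_prop) fun t ht => Or.inl (hsin t ht).ne')
  have hmψ : AEStronglyMeasurable ψ (volume.restrict (Ioo 0 θ)) := by
    refine (ContinuousOn.mono ?_ hsub').aestronglyMeasurable measurableSet_Ioo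
    exact ContinuousOn.rpow_const (by fun_prop) fun t ht => Or.inl (hsin t ht).ne'
  have iΦ2 : Integrable (fun t => Φ t ^ 2) (volume.restrict (Ioo 0 θ)) := by
    have h := (hB.mono_set hsub')
    refine (integrableOn_congr_fun (fun t ht => (hΦ2 t (hsub' ht))) measurableSet_Ioo).2 h
  have iψ2 : Integrable (fun t => ψ t ^ 2) (volume.restrict (Ioo 0 θ)) := by
    have h := (hW.mono_set hsub')
    refine (integrableOn_congr_fun (fun t ht => (hψ2 t (hsub' ht))) measurableSet_Ioo).2 h
  have iΦψ : Integrable (fun t => Φ t * ψ t) (volume.restrict (Ioo 0 θ)) := by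
    -- `2|Φψ| ≤ Φ² + ψ²`
    refine Integrable.mono' (iΦ2.add iψ2) (hmΦ.mul hmψ) (Filter.Eventually.of_forall fun t => ?_)
    rw [Real.norm_eq_abs, abs_mul]
    simp only [Pi.add_apply]
    nlinarith [sq_nonneg (|Φ t| - |ψ t|), abs_nonneg (Φ t), abs_nonneg (ψ t), sq_abs (Φ t), sq_abs (ψ t)]
  have hCS := sq_integral_mul_le iΦ2 iψ2 iΦψ
  -- compare the factors with the global quantities
  have hA : ∫ t in Ioo 0 θ, Φ t ^ 2 ≤ ∫ t in Ioo 0 (π / 2), deriv g t ^ 2 * Real.sin (2 * t) ^ (2 - γ) := by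
    rw [setIntegral_congr_fun measurableSet_Ioo fun t ht => hΦ2 t (hsub' ht)]
    exact setIntegral_mono_set hB (by
      rw [EventuallyLE, ae_restrict_iff' measurableSet_Ioo]
      exact Filter.Eventually.of_forall fun t ht => mul_nonneg (sq_nonneg _) (Real.rpow_nonneg (hsin t ht).le _))
      (ae_of_all _ hsub')
  have hBψ : ∫ t in Ioo 0 θ, ψ t ^ 2 ≤ π / (γ - 1) := by
    rw [setIntegral_congr_fun measurableSet_Ioo fun t ht => hψ2 t (hsub' ht)]
    refine le_trans ?_ hWle
    exact setIntegral_mono_set hW (by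
      rw [EventuallyLE, ae_restrict_iff' measurableSet_Ioo]
      exact Filter.Eventually.of_forall fun t ht => Real.rpow_nonneg (hsin t ht).le _) (ae_of_all _ hsub')
  have hψnn : 0 ≤ ∫ t in Ioo 0 θ, ψ t ^ 2 := integral_nonneg fun t => sq_nonneg _
  rw [hFTC, hrepr]
  calc (∫ t in Ioo 0 θ, Φ t * ψ t) ^ 2 ≤ (∫ t in Ioo 0 θ, Φ t ^ 2) * ∫ t in Ioo 0 θ, ψ t ^ 2 := hCS
    _ ≤ (∫ t in Ioo 0 (π / 2), deriv g t ^ 2 * Real.sin (2 * t) ^ (2 - γ)) * (π / (γ - 1)) :=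
        mul_le_mul hA hBψ hψnn hBnn
    _ = π / (γ - 1) * ∫ t in Ioo 0 (π / 2), deriv g t ^ 2 * Real.sin (2 * t) ^ (2 - γ) := by rw [mul_comm]

end Elgindi

end Literature.Analysis.FluidPDE
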